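import Literature.Claims.NS.ClayVariants
import Literature.Analysis.FluidPDE.ClassicalSolutionRegion
import HarnessLib

/-!
# Claim skeleton (D-0090 NS-CLAIMS, C44): W. S. Khedr, «Nonconvection and uniqueness in Navier-Stokes
# equation», arXiv:1706.02552 v1 (4 Jun 2017, math.GM) — the «every solution is ψ(x,t)u(t)» claim

Cell `ns-claims`, row C44 (T3 tail of QUEUE v1.17), typist `ns-claims-typist-12` (lanes: refuter first idle
(PREDICTED-R), ref-2 g2, salvage by family (p1 g2), writer-2; lit = lit-3 stub, seat closed). Text of
record: arXiv 1706.02552 **v1** (only version; TeX `pub/ns-claims/sources/Khedr2017/arXiv-1706.02552v1-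
TeX_PINNED/NewConcept1_v3.tex`, 402 lines — locators are TeX LINES `l.N`; PDF pages ≈ 9), bib `Khedr2017`.
UNREFEREED CLAIM under adjudication — NOTHING in this file asserts a step: every `Step_k`/`ClaimedTheorem` is
a `Prop`; the `theorem`s are kernel compositions of the paper's own implications. Card
`pub/ns-claims/claims/Khedr2017/CARD.md` (PREDICTION §4 frozen 2026-08-27T00:43:17Z, sha16 54be44dfee93062d).

## Claimed statement (as printed)

Abstract l.60 ff. / §4 l.310–313: «In the presence of a certain class of functions we show that there exists
a smooth solution to Navier-Stokes equation. This solution entertains the property of being nonconvective …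
we prove that the proposed class of functions represents the unique solution to the problem and consequently
we conclude that there exists no convective solutions»; «This form of uniqueness implies that Navier-Stokes
equation is not convective and it can be reduced to a linear model.» **Claim 1 l.163–166**: «Any solution to
Model Equations (vmodel), in the sense of Definition (defv), is nonconvective and it takes the form v(x,t) =
ψ(x,t)u(t) where ψ : ℝ^N × ℝ → ℝ is a scalar field and u = (u₁(t),…,u_N(t)) is a vector field independent of
x.» **Theorem (Uniqueness) l.257–260**: «Let Ω, v₀ and F be chosen arbitrarily. Any possible solution to Model
Equation (vmodel), in the sense of Definition (defv), is in the form v = ψ(x,t)u(t). In particular, it is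
non-convective.» **Corollary l.306**: «Claim 1 is true.» Setting §2 l.96–153: `Ω` a bounded region of `ℝ^N`
or all of `ℝ^N`; (vmodel) l.126–145 = Navier–Stokes with viscosity `μ`, force `F`, boundary datum `v = v*`
on `∂Ω`, `∇·v = 0` (the vorticity `ω = ∇ × v` carried along); Definition (defv) l.154: «v is a possible
solution … if v ∈ L²(Ω) for every t > 0». Theorem (Existence and smoothness) l.206 ff.: for data of the
separated class, a smooth solution via the heat equation (step1) and the Poisson equation (step2).

RENDERING: `N = 3`; the model on the space–time region `(0,∞) × D`, `D ⊆ ℝ³` open (the tree's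
`IsClassicalNSSolutionOnRegion`, classical solutions; boundary and initial data «chosen arbitrarily» impose no
constraint), with Definition (defv)'s `v(t) ∈ L²(D)` for `t > 0` as a hypothesis. `ClaimedTheorem` = Claim 1
/ Theorem (Uniqueness) so rendered. The decisive printed device — «the eigen value representation of the
tensor ∇V applied to the vector V takes the form ∇V V = λ_V V» (Lemma l.188–192; used at l.270–290 also in the
form `∇W a = λ_W a` for other vectors `a`) — is typed at its own grain (`EigenRepSelf`, `EigenRepAll`).

## Clay delta (reference `Literature.Claims.NS.ClayVariants`, axes Δ1–Δ8)

No Clay counterpart: the load-bearing content is a STRUCTURE/uniqueness statement (Δ6: «every solution is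
of separated form»); the existence theorem covers only the separated class (Δ4). Nearest (A) for the
abstract's «there exists a smooth solution to Navier-Stokes equation»; the passage to (A) is `Step_bridge`
(unproved Prop; Δ4/Δ6 carrier).

## Steps — ORDERED INDEX (TYPING-HYGIENE 11; print order)

Step 1 = Lemma (Tangential flow) l.175 (separated solenoidal fields are tangential; proof «identical to
[khedrN, Lemma 1]»; quoted) · **Step 2 = `EigenRepSelf` / `EigenRepAll`** (Lemma l.188, first sentence of
its proof l.190–192: «The eigen value representation of the tensor ∇V applied to the vector V takes the form
∇V V = λ_V V»; re-used l.275–290 with `∇W W = λ_W W`, `∇W V = λ_W V` and in (diffequ1**) with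
`(∇W)V^g·V^g = λ_W|V^g|²` — i.e. every vector an eigenvector of the velocity-gradient tensor with one scalar
field `λ`; typist's flag: suspicious — LOAD-BEARING for (diffequ1**)–(diffeque4)) · Step 3 = Theorem
(Existence and smoothness) l.206 ff. (`ExistenceSeparated`: heat + Poisson for separated data; proof l.238 ff.
«If V = ψU then (V·∇)V = 0» (true for solenoidal separated fields); typist's flag: plausible, not composed) ·
**Step 4 = `ClaimedTheorem`** (Theorem (Uniqueness) l.257–260 = Claim 1, via the energy estimate
(diffequ1)–(diffeque4) l.262–300 which consumes Step 2; typist's flag: suspicious — the tree's ABC/Beltrami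
flows `Literature.Analysis.FluidPDE.Beltrami.abc` are classical solutions whose direction varies in `x`) ·
Step 5 = `Step_bridge` (abstract's existence sentence read toward (A)).

## COMPOSITION

`claim_of_steps : Step_uniqProof → EigenRepAll → ClaimedTheorem`, where `Step_uniqProof` is the printed
implication «eigenvalue representation ⇒ uniqueness» (proof l.261–300) — PROVED (modus ponens). The abstract
companion `EigenRepSelf` is the lemma's literal first sentence.

WHAT THIS IS NOT: not a claim about NS regularity or blow-up; not a claim about any author beyond the
typed locator.
-/

noncomputable section

open Set Function MeasureTheory
open scoped ContDiff
open Literature.Analysis.FluidPDE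

namespace Literature.Claims.NS.Khedr2017

/-- `ℝ³` (the paper's `ℝ^N`, rendered at `N = 3`). [cite: Khedr2017, §2 l.96–98] -/
abbrev E3 := EuclideanSpace ℝ (Fin 3)

/-- **Separated («nonconvective») form, Claim 1 l.163–166**: `v(x,t) = ψ(x,t) u(t)` on the region, with
`ψ` scalar and `u` independent of `x`. [cite: Khedr2017, Claim 1 l.163–166] -/
def IsSeparatedOn (D : Set E3) (v : ℝ → E3 → E3) : Prop :=
  ∃ (ψ : ℝ → E3 → ℝ) (U : ℝ → E3), ∀ t : ℝ, 0 < t → ∀ x ∈ D, v t x = ψ t x • U t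

/-- **«Possible solution» of (vmodel), Definition (defv) l.154 with the model l.126–145, rendered**: a
classical solution `(v, p)` of Navier–Stokes with viscosity `μ` and force `F` on the open space–time region
`(0,∞) × D` (tree vocabulary `IsClassicalNSSolutionOnRegion`; boundary and initial data are «chosen
arbitrarily», hence unconstrained), with `v(t) ∈ L²(D)` for every `t > 0`.
[cite: Khedr2017, (vmodel) l.126–145; Definition l.154] -/
def IsPossibleSolution (μ : ℝ) (D : Set E3) (F v : ℝ → E3 → E3) (p : ℝ → E3 → ℝ) : Prop :=
  IsClassicalNSSolutionOnRegion (Ioi (0:ℝ) ×ˢ D) μ F v p ∧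
    ∀ t : ℝ, 0 < t → Integrable (fun x => ‖v t x‖ ^ 2) (volume.restrict D)

/-! ### The claimed statement -/

/-- **Claim 1 l.163–166 = Theorem (Uniqueness) l.257–260 = Corollary l.306 (rendered at `N = 3`)**: «Let
Ω, v₀ and F be chosen arbitrarily. Any possible solution to Model Equation (vmodel), in the sense of
Definition (defv), is in the form v = ψ(x,t)u(t). In particular, it is non-convective.» For every `μ > 0`,
every open `D ⊆ ℝ³`, every force and every possible solution: separated form on `(0,∞) × D`. Typist's flag:
suspicious. [cite: Khedr2017, Theorem (Uniqueness) l.257–260; Claim 1 l.163–166; Corollary l.306] -/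
def ClaimedTheorem : Prop :=
  ∀ μ : ℝ, 0 < μ → ∀ D : Set E3, IsOpen D → ∀ (F v : ℝ → E3 → E3) (p : ℝ → E3 → ℝ),
    IsPossibleSolution μ D F v p → IsSeparatedOn D v

/-! ### The steps -/

/-- **Step 2 — Lemma l.188, proof l.190–192, literal**: «The eigen value representation of the tensor ∇V
applied to the vector V takes the form ∇V V = λ_V V» — every (smooth) vector field is pointwise an
eigenvector of its own gradient tensor: there is a scalar field `λ` with `DV(x)[V(x)] = λ(x) V(x)` for all
`x`. Typist's flag: suspicious (rigid rotation `V = (x₂, −x₁, 0)`: `DV·V = (−x₁, −x₂, 0) ⊥ V`).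
[cite: Khedr2017, Lemma l.188–192] -/
def EigenRepSelf : Prop :=
  ∀ V : E3 → E3, ContDiff ℝ ∞ V → ∃ lam : E3 → ℝ, ∀ x : E3, fderiv ℝ V x (V x) = lam x • V x

/-- **Step 2, as used l.270–290** («∇W W = λ_W W», «One can write also ∇W V = λ_W V», and (diffequ1**):
`(∇W)V^g · V^g = λ_W |V^g|²`): the SAME scalar field `λ_W` serves every vector — `DW(x)[a] = λ_W(x) a` for
all `a`. Typist's flag: suspicious (then `DW(x)` is a multiple of the identity; with `∇·W = 0`, `DW = 0`).
[cite: Khedr2017, proof of Theorem (Uniqueness) l.270–290] -/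
def EigenRepAll : Prop :=
  ∀ W : E3 → E3, ContDiff ℝ ∞ W → ∃ lam : E3 → ℝ, ∀ x a : E3, fderiv ℝ W x a = lam x • a

/-- **Step 3 — Theorem (Existence and smoothness) l.206 ff. (rendered, `D = ℝ³`, `F = 0`)**: a separated,
smooth, divergence-free datum `ψ₀(x) U₀` launches a global classical solution on `(0,∞) × ℝ³` which stays
separated («Model Equation (vmodel) is reduced to V_t − μΔV = −∇p + F … a standard heat equation»).
Typist's flag: plausible (heat flow of `ψ₀` times `U₀`, `p = 0`); not composed.
[cite: Khedr2017, Theorem (Existence and smoothness) l.206–250] -/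
def ExistenceSeparated : Prop :=
  ∀ μ : ℝ, 0 < μ → ∀ (ψ₀ : E3 → ℝ) (U₀ : E3), ContDiff ℝ ∞ ψ₀ →
    VectorCalculus.IsDivFree (fun x => ψ₀ x • U₀) → HasRapidSpatialDecay (fun x => ψ₀ x • U₀) →
      ∃ (v : ℝ → E3 → E3) (p : ℝ → E3 → ℝ),
        IsClassicalNSSolutionOn (Ici 0) μ 0 v p ∧ v 0 = (fun x => ψ₀ x • U₀) ∧ IsSeparatedOn univ v

/-- **Step 4 — the printed uniqueness proof l.261–300 as an implication**: the eigenvalue representation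
(Step 2, in the form used) yields the theorem (energy estimate on `w = v − v^g`: (diffequ1) → (diffequ1*) →
(diffequ1**) `½ d/dt ∫|w|² ≤ −∫ λ_w |v^g|²` → (diffeque2)–(diffeque4) → `d/dt ‖w‖ ≤ 0`). TYPED as the
implication the proof establishes if its displayed manipulations are granted. Typist's flag: suspicious
(it also uses the separated candidate as a solution of the SAME problem for arbitrary data, l.262).
[cite: Khedr2017, proof of Theorem (Uniqueness) l.261–300] -/
def Step_uniqProof : Prop :=
  EigenRepAll → ClaimedTheorem

/-- **Step 5 — the abstract's existence sentence read toward Clay (A)** («we show that there exists a smooth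
solution to Navier-Stokes equation», l.60; §4 «it can be reduced to a linear model»): the claimed structure
theorem would turn (A) into the solvability of heat equations. TYPED as the bridge; it carries Δ4/Δ6 (the
existence theorem covers separated data only). Typist's flag: suspicious. [cite: Khedr2017, abstract l.60;
§4 l.310–313] -/
def Step_bridge : Prop :=
  ClaimedTheorem → ClayVariants.clayR3.Regularity

/-! ### Kernel relations -/

/-- **KERNEL COMPOSITION** — Claim 1 from the printed proof and the eigenvalue representation it consumes.
[cite: Khedr2017, Theorem (Uniqueness) l.257–300; Corollary l.306] -/
theorem claim_of_steps (hpf : Step_uniqProof) (heig : EigenRepAll) : ClaimedTheorem :=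
  hpf heig

/-- The form used (every vector an eigenvector) contains the literal first sentence (the field itself an
eigenvector). [cite: Khedr2017, Lemma l.188–192; l.270–290] -/
theorem eigenRepSelf_of_all (h : EigenRepAll) : EigenRepSelf := by
  intro V hV
  obtain ⟨lam, hlam⟩ := h V hV
  exact ⟨lam, fun x => hlam x (V x)⟩

/-- Clay (A) from the claim and the bridge (modus ponens; recorded for the MAP's Clay column).
[cite: Khedr2017, abstract l.60] -/
theorem clay_of_claimed_and_bridge (hC : ClaimedTheorem) (hbr : Step_bridge) :
    ClayVariants.clayR3.Regularity :=
  hbr hC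

/-- The rest state solves the unforced system classically on any time set (every term of the momentum
equation vanishes). [cite: FeffermanClay2006, (1) (2) (6) p. 1] -/
private theorem isClassicalNSSolutionOn_rest (S : Set ℝ) (ν : ℝ) :
    IsClassicalNSSolutionOn S ν 0 (fun _ _ => (0 : E3)) (fun _ _ => (0 : ℝ)) := by
  refine ⟨contDiffOn_const, contDiffOn_const, fun t _ x => ?_, fun t _ x => ?_⟩
  · have h1 : timeDerivWithin S (fun (_ : ℝ) (_ : E3) => (0 : E3)) t x = 0 := by
      simp [timeDerivWithin]
    have h2 : convect (fun _ : E3 => (0 : E3)) (fun _ : E3 => (0 : E3)) x = 0 := by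
      simp [convect]
    have h3 : gradient (fun _ : E3 => (0 : ℝ)) x = 0 := by
      rw [gradient, fderiv_const_apply]; simp
    rw [h1, h2, h3, InnerProductSpace.laplacian_const]
    simp
  · simp [VectorCalculus.divergence, fderiv_const_apply]

/-- The divergence of a separated field `x ↦ ψ₀(x) U₀` is the directional derivative `Dψ₀(x)[U₀]`.
[folklore] -/
private theorem divergence_smul_const {ψ₀ : E3 → ℝ} {x : E3} (hψ : DifferentiableAt ℝ ψ₀ x) (U₀ : E3) :
    VectorCalculus.divergence (fun z => ψ₀ z • U₀) x = fderiv ℝ ψ₀ x U₀ := by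
  unfold VectorCalculus.divergence
  rw [fderiv_smul_const hψ U₀]
  exact LinearMap.trace_smulRight _ _

/-- **The separated data class of the existence theorem is trivial**: a smooth separated field
`x ↦ ψ₀(x) U₀` that is divergence free (so `ψ₀` is constant along every line in direction `U₀`) and
has Clay's rapid decay vanishes identically. (Private observation used to discharge
`ExistenceSeparated`; not a printed statement.) [folklore] -/
private theorem separatedDatum_eq_zero {ψ₀ : E3 → ℝ} {U₀ : E3} (hψ : ContDiff ℝ ∞ ψ₀)
    (hdiv : VectorCalculus.IsDivFree (fun x => ψ₀ x • U₀))
    (hdec : HasRapidSpatialDecay (fun x => ψ₀ x • U₀)) :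
    (fun x => ψ₀ x • U₀) = fun _ => (0 : E3) := by
  funext x
  by_cases hU : U₀ = 0
  · simp [hU]
  -- `ψ₀` is constant along the line `t ↦ x + t • U₀`
  have hdiff : Differentiable ℝ ψ₀ := hψ.differentiable (by simp)
  set φ : ℝ → ℝ := fun t => ψ₀ (x + t • U₀) with hφ
  have hderiv : ∀ t, HasDerivAt φ 0 t := by
    intro t
    have hline : HasDerivAt (fun s : ℝ => x + s • U₀) U₀ t := by
      simpa using ((hasDerivAt_id t).smul_const U₀).const_add x
    have hcomp : HasDerivAt φ (fderiv ℝ ψ₀ (x + t • U₀) U₀) t :=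
      (hdiff (x + t • U₀)).hasFDerivAt.comp_hasDerivAt t hline
    have hzero : fderiv ℝ ψ₀ (x + t • U₀) U₀ = 0 := by
      rw [← divergence_smul_const (hdiff _) U₀]; exact hdiv _
    rw [hzero] at hcomp
    exact hcomp
  have hconst : ∀ t, φ t = φ 0 := fun t =>
    is_const_of_deriv_eq_zero (fun t => (hderiv t).differentiableAt) (fun t => (hderiv t).deriv) t 0
  -- decay with `n = 0`, `K = 1` along the line forces `ψ₀ x = 0`
  obtain ⟨C, hC⟩ := hdec 0 1
  by_contra hne
  have hψx : ψ₀ x ≠ 0 := by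
    intro h; exact hne (by simp [h])
  have hpos : 0 < |ψ₀ x| * ‖U₀‖ := mul_pos (abs_pos.mpr hψx) (norm_pos_iff.mpr hU)
  -- choose `t` large
  obtain ⟨t, ht⟩ : ∃ t : ℝ, C < (1 + (t * ‖U₀‖ - ‖x‖)) * (|ψ₀ x| * ‖U₀‖) ∧ 0 ≤ t := by
    refine ⟨(|C| / (|ψ₀ x| * ‖U₀‖) + ‖x‖ + 1) / ‖U₀‖, ?_, by positivity⟩
    have hU' : 0 < ‖U₀‖ := norm_pos_iff.mpr hU
    rw [div_mul_cancel₀ _ hU'.ne']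
    have : |C| / (|ψ₀ x| * ‖U₀‖) * (|ψ₀ x| * ‖U₀‖) = |C| := div_mul_cancel₀ _ hpos.ne'
    nlinarith [le_abs_self C, this, hpos]
  have hval : ‖iteratedFDeriv ℝ 0 (fun z => ψ₀ z • U₀) (x + t • U₀)‖ = |ψ₀ x| * ‖U₀‖ := by
    rw [norm_iteratedFDeriv_zero, norm_smul, Real.norm_eq_abs]
    have : ψ₀ (x + t • U₀) = ψ₀ x := by simpa [hφ] using hconst t
    rw [this]
  have hbound := hC (x + t • U₀)
  rw [pow_one, hval] at hbound
  have hnorm : t * ‖U₀‖ - ‖x‖ ≤ ‖x + t • U₀‖ := by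
    have h1 : ‖t • U₀‖ ≤ ‖x + t • U₀‖ + ‖x‖ := by
      calc ‖t • U₀‖ = ‖(x + t • U₀) - x‖ := by simp
        _ ≤ ‖x + t • U₀‖ + ‖x‖ := norm_sub_le _ _
    rw [norm_smul, Real.norm_eq_abs, abs_of_nonneg ht.2] at h1
    linarith
  have : (1 + (t * ‖U₀‖ - ‖x‖)) * (|ψ₀ x| * ‖U₀‖) ≤ (1 + ‖x + t • U₀‖) * (|ψ₀ x| * ‖U₀‖) :=
    mul_le_mul_of_nonneg_right (by linarith) hpos.le
  linarith [ht.1]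

/-- **Step 3 HOLDS (kernel)** — the existence theorem for separated data (l.206–250): a smooth,
divergence-free, rapidly decaying separated datum `ψ₀(x) U₀` launches a global classical solution that
stays separated. In the kernel this holds because the hypotheses force the datum to VANISH (divergence
free ⇒ `ψ₀` constant along the direction `U₀`; rapid decay ⇒ that constant is `0`, unless `U₀ = 0`), so
the rest state `(0, 0)` is the required global separated solution. Net Literature debt −1; no statement
of this file is changed. [cite: Khedr2017, Theorem (Existence and smoothness) l.206–250]
[cite: FeffermanClay2006, (4) p. 1] -/
theorem existenceSeparated_holds : ExistenceSeparated := by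
  intro μ _ ψ₀ U₀ hψ hdiv hdec
  refine ⟨fun _ _ => 0, fun _ _ => 0, isClassicalNSSolutionOn_rest (Ici 0) μ, ?_, ?_⟩
  · exact (separatedDatum_eq_zero hψ hdiv hdec).symm
  · exact ⟨fun _ _ => 0, fun _ => 0, fun t _ x _ => by simp⟩

end Literature.Claims.NS.Khedr2017

end
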